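import Summits.ValiantsHypothesis.ValiantsHypothesis.Theorems.LacunarySymmetroidMatrixDescartesCensusRealExponents

/-!
# `MatrixDescartes` census — SHARP ROWS ARE DECIDED ON ANY DENSE FAMILY OF SYMMETRIC LETTER TUPLES (openness of `Z₊ ≥ B+1` in the
# letters); in particular `DoorA34` / `DoorA26` reduce to their rows on a dense family

HONEST FRAMING.  Object-search cell `pub-symmetroid`, door-A seat `val-sym-door-p3` (g17); items stmt-ValiantsHypothesis-19980
`DoorA34 = PosRootLawAt 3 4 18` and stmt-ValiantsHypothesis-19979 `DoorA26 = PosRootLawAt 2 6 19` are OPEN and asserted nowhere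
in this file.  Nothing here bounds `ζ_sym`; nothing bears on `MatrixDescartes` (stmt-ValiantsHypothesis-18050) or on `VP ≠ VNP`.

CONTENT (every format `(m, K)` and every SHARP bound `B`, i.e. `#{λ : Fin m → Fin K monotone} ≤ B + 2` — Descartes ceiling minus one
or more; all supports; no `def`, no `sorry`).  Companion of `…CensusRealExponents{,Doors}` (persistent sign brackets in `t = log x`,
openness of the residue in the EXPONENTS); here the perturbation is in the LETTERS:
* `continuous_det_expPencil_letters` — `S ↦ det ∑_l e^{δ_l t} S_l` is continuous;
* `card_posRoots_eq_ncard_exp` — on an integer support the census count `#{x > 0 : det ∑ x^{d_l} S_l = 0}` (distinct roots of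
  the determinant polynomial) is the `ncard` of the zero set of `t ↦ det ∑ e^{d_l t} S_l` (when the determinant polynomial is non-zero);
* **`exists_nhd_le_card_posRoots`** — PERSISTENCE: if a pencil on an integer support `d` has `≥ B + 1` distinct positive det-roots
  (`B` sharp), then so does every pencil on `d` with letters close enough (all `B + 1` roots are simple by sharpness —
  `RealExp.exists_persistent_brackets` at `δ' = δ` — and sign brackets persist under perturbation of the letters; product topology, no norm chosen);
  **`isOpen_setOf_le_card_posRoots`** — the locus `{S : Z₊(d, S) ≥ B + 1}` is OPEN in `(Fin K → Matrix (Fin m) (Fin m) ℝ)`;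
* **`posRootLawOn_of_denseRows`**, **`posRootLawAt_of_denseRows`** — if a family `𝒢` of letter tuples is DENSE AMONG SYMMETRIC TUPLES
  (every neighbourhood of a symmetric tuple contains symmetric members of `𝒢`; product topology) and the row `≤ B` holds on `𝒢`, then the row holds;
  `doorA34_iff_denseRows`, `doorA26_iff_denseRows` — the two doors are equivalent to their rows on any such dense family.
USE.  With the chart theorems `…CensusDoorA34EqualDiagonalChartRows` / `…CensusDoorA34HollowCornerChart` this reduces `DoorA34` to
sixteen-parameter chart rows AS SOON AS the density of the charted sector (nets whose annihilator pencil is really split / carries a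
real line pair with non-isotropic vertex — all generic nets) is recorded in the kernel; that density statement is NOT proved here.
[folklore] Simple roots persist (intermediate value theorem); elementary topology.
-/

-- `Summit.ValiantsHypothesis.ValiantsHypothesis.…` repeats a component by the D-0017 layout
-- (single-conjunct summit), which the `dupNamespace` linter flags; the name is mandated.
set_option linter.dupNamespace false

namespace Summit.ValiantsHypothesis.ValiantsHypothesis.Theorems.LacunarySymmetroidMatrixDescartes.Census.DenseRows

open Finset Filter Topology Polynomial
open scoped BigOperators Matrix
open Summit.ValiantsHypothesis.ValiantsHypothesis.Theorems.MatrixDescartes.Negative (PosRootLawAt)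
open Summit.ValiantsHypothesis.ValiantsHypothesis.Theorems.SymmetroidDescartes (eval_det_pencil)
open Summit.ValiantsHypothesis.ValiantsHypothesis.Theorems.LacunarySymmetroidMatrixDescartes.Census.RealExp

variable {m K : ℕ}

/-- For fixed `δ, t` the determinant `S ↦ det ∑_l e^{δ_l t} S_l` is continuous in the letters. [folklore] -/
theorem continuous_det_expPencil_letters (δ : Fin K → ℝ) (t : ℝ) :
    Continuous fun S : Fin K → Matrix (Fin m) (Fin m) ℝ => (∑ l, Real.exp (δ l * t) • S l).det :=
  Continuous.matrix_det <| by fun_prop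

/-- The positive roots of the determinant polynomial on an integer support are the positive zeros of `x ↦ det ∑ x^{d_l} S_l`
(real powers). [folklore] -/
theorem coe_posRoots_eq (d : Fin K → ℕ) (S : Fin K → Matrix (Fin m) (Fin m) ℝ)
    (hP : (∑ l, (X : ℝ[X]) ^ d l • (S l).map C).det ≠ 0) :
    (↑((∑ l, (X : ℝ[X]) ^ d l • (S l).map C).det.roots.toFinset.filter (fun x => 0 < x)) : Set ℝ)
      = {x : ℝ | 0 < x ∧ (∑ l, (x ^ ((fun l => (d l : ℝ)) l)) • S l).det = 0} := by
  ext x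
  rw [Finset.coe_filter, Set.mem_setOf_eq, Set.mem_setOf_eq, Multiset.mem_toFinset, mem_roots hP, IsRoot.def, eval_det_pencil]
  simp only [Real.rpow_natCast]
  exact and_comm

/-- On an integer support, the census count equals the number of zeros of `t ↦ det ∑ e^{d_l t} S_l` (`x = e^t`), provided the
determinant polynomial is non-zero. [folklore] -/
theorem card_posRoots_eq_ncard_exp (d : Fin K → ℕ) (S : Fin K → Matrix (Fin m) (Fin m) ℝ)
    (hP : (∑ l, (X : ℝ[X]) ^ d l • (S l).map C).det ≠ 0) :
    ((∑ l, (X : ℝ[X]) ^ d l • (S l).map C).det.roots.toFinset.filter (fun x => 0 < x)).card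
      = {t : ℝ | (∑ l, Real.exp ((d l : ℝ) * t) • S l).det = 0}.ncard := by
  rw [← ncard_rpow_eq_ncard_exp (fun l => (d l : ℝ)) S, ← coe_posRoots_eq d S hP, Set.ncard_coe_finset]

/-- **PERSISTENCE OF A SHARP COUNT UNDER PERTURBATION OF THE LETTERS.**  Let `B` be sharp for the format
(`#{monotone λ} ≤ B + 2`).  If a pencil on the integer support `d` has at least `B + 1` distinct positive det-roots, then every pencil on
`d` whose letters lie in a suitable NEIGHBOURHOOD (product topology on `Fin K → Matrix (Fin m) (Fin m) ℝ`) has at least `B + 1` distinct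
positive det-roots: by sharpness all those roots are simple (`RealExp.exists_persistent_brackets`), so they are strict sign changes of
`t ↦ det ∑ e^{d_l t} S_l`, which persist. [folklore] -/
theorem exists_nhd_le_card_posRoots {B : ℕ}
    (hB : (univ.filter (fun lam : Fin m → Fin K => Monotone lam)).card ≤ B + 2)
    (d : Fin K → ℕ) (S : Fin K → Matrix (Fin m) (Fin m) ℝ)
    (hcount : B + 1 ≤ ((∑ l, (X : ℝ[X]) ^ d l • (S l).map C).det.roots.toFinset.filter (fun x => 0 < x)).card) :
    ∃ U : Set (Fin K → Matrix (Fin m) (Fin m) ℝ), IsOpen U ∧ S ∈ U ∧ ∀ S' ∈ U,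
      B + 1 ≤ ((∑ l, (X : ℝ[X]) ^ d l • (S' l).map C).det.roots.toFinset.filter (fun x => 0 < x)).card := by
  classical
  set δ : Fin K → ℝ := fun l => (d l : ℝ) with hδ
  have hP : (∑ l, (X : ℝ[X]) ^ d l • (S l).map C).det ≠ 0 := by
    intro h0; rw [h0] at hcount; simp at hcount
  have hcount' : B + 1 ≤ {t : ℝ | (∑ l, Real.exp (δ l * t) • S l).det = 0}.ncard := by
    rw [← card_posRoots_eq_ncard_exp d S hP]; exact hcount
  obtain ⟨n, hnB, a, b, hab, hdisj, r, hr, hball⟩ := exists_persistent_brackets hB δ S hcount'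
  have hsign : ∀ i, (∑ l, Real.exp (δ l * a i) • S l).det * (∑ l, Real.exp (δ l * b i) • S l).det < 0 :=
    hball δ (by rw [dist_self]; exact hr)
  -- the brackets persist under perturbation of the letters
  set U : Set (Fin K → Matrix (Fin m) (Fin m) ℝ) :=
    {S' | ∀ i, (∑ l, Real.exp (δ l * a i) • S' l).det * (∑ l, Real.exp (δ l * b i) • S' l).det < 0} with hU
  have hUopen : IsOpen U := by
    have : U = ⋂ i, {S' : Fin K → Matrix (Fin m) (Fin m) ℝ |
        (∑ l, Real.exp (δ l * a i) • S' l).det * (∑ l, Real.exp (δ l * b i) • S' l).det < 0} := by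
      ext S'; simp [hU]
    rw [this]
    exact isOpen_iInter_of_finite fun i =>
      isOpen_lt ((continuous_det_expPencil_letters δ (a i)).mul (continuous_det_expPencil_letters δ (b i))) continuous_const
  refine ⟨U, hUopen, hsign, fun S' hS'U => ?_⟩
  have hbr := le_ncard_of_brackets δ S' (by omega) hab hdisj hS'U
  -- back to the polynomial currency
  have hP' : (∑ l, (X : ℝ[X]) ^ d l • (S' l).map C).det ≠ 0 := by
    intro h0
    have hn0 : 0 < n := by omega
    have h1 : ((∑ l, (X : ℝ[X]) ^ d l • (S' l).map C).det).eval (Real.exp (a ⟨0, hn0⟩)) = 0 := by rw [h0, eval_zero]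
    rw [eval_det_pencil] at h1
    have h2 : (∑ l, Real.exp (δ l * a ⟨0, hn0⟩) • S' l).det = 0 := by
      have : (fun l => Real.exp (a ⟨0, hn0⟩) ^ d l • S' l) = fun l => Real.exp (δ l * a ⟨0, hn0⟩) • S' l := by
        funext l; rw [hδ]; simp only; rw [← Real.exp_nat_mul]
      rw [← this]; exact h1
    have h3 := hS'U ⟨0, hn0⟩
    rw [h2, zero_mul] at h3
    exact lt_irrefl 0 h3
  rw [card_posRoots_eq_ncard_exp d S' hP']
  exact hnB.trans hbr.2

/-- **OPENNESS**: for a sharp bound the locus of letter tuples carrying `≥ B + 1` distinct positive det-roots on a fixed integer support is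
open (product topology). [folklore] -/
theorem isOpen_setOf_le_card_posRoots {B : ℕ}
    (hB : (univ.filter (fun lam : Fin m → Fin K => Monotone lam)).card ≤ B + 2) (d : Fin K → ℕ) :
    IsOpen {S : Fin K → Matrix (Fin m) (Fin m) ℝ |
      B + 1 ≤ ((∑ l, (X : ℝ[X]) ^ d l • (S l).map C).det.roots.toFinset.filter (fun x => 0 < x)).card} := by
  rw [isOpen_iff_forall_mem_open]
  intro S hS
  obtain ⟨U, hU, hSU, hball⟩ := exists_nhd_le_card_posRoots hB d S hS
  exact ⟨U, fun S' hS' => hball S' hS', hU, hSU⟩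

/-- **DENSE FAMILIES DECIDE SHARP ROWS (support level).**  Let `B` be sharp and let `𝒢` be a family of letter tuples that is dense
among the SYMMETRIC tuples.  If every symmetric member of `𝒢` has `≤ B` distinct positive det-roots on `d`, then `PosRootLawOn m K B d`.
[folklore] -/
theorem posRootLawOn_of_denseRows {B : ℕ}
    (hB : (univ.filter (fun lam : Fin m → Fin K => Monotone lam)).card ≤ B + 2) (d : Fin K → ℕ)
    (𝒢 : Set (Fin K → Matrix (Fin m) (Fin m) ℝ))
    (hdense : ∀ S : Fin K → Matrix (Fin m) (Fin m) ℝ, (∀ l, (S l).IsSymm) →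
      ∀ U : Set (Fin K → Matrix (Fin m) (Fin m) ℝ), IsOpen U → S ∈ U → ∃ S' ∈ 𝒢, (∀ l, (S' l).IsSymm) ∧ S' ∈ U)
    (hrows : ∀ S ∈ 𝒢, (∀ l, (S l).IsSymm) →
      ((∑ l, (X : ℝ[X]) ^ d l • (S l).map C).det.roots.toFinset.filter (fun x => 0 < x)).card ≤ B) :
    PosRootLawOn m K B d := by
  intro S hS
  by_contra hcon
  push Not at hcon
  obtain ⟨U, hU, hSU, hball⟩ := exists_nhd_le_card_posRoots hB d S (by omega)
  obtain ⟨S', hS'𝒢, hS'symm, hS'U⟩ := hdense S hS U hU hSU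
  have h1 := hball S' hS'U
  have h2 := hrows S' hS'𝒢 hS'symm
  omega

/-- **DENSE FAMILIES DECIDE SHARP ROWS (format level).** [folklore] -/
theorem posRootLawAt_of_denseRows {B : ℕ}
    (hB : (univ.filter (fun lam : Fin m → Fin K => Monotone lam)).card ≤ B + 2)
    (𝒢 : Set (Fin K → Matrix (Fin m) (Fin m) ℝ))
    (hdense : ∀ S : Fin K → Matrix (Fin m) (Fin m) ℝ, (∀ l, (S l).IsSymm) →
      ∀ U : Set (Fin K → Matrix (Fin m) (Fin m) ℝ), IsOpen U → S ∈ U → ∃ S' ∈ 𝒢, (∀ l, (S' l).IsSymm) ∧ S' ∈ U)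
    (hrows : ∀ (d : Fin K → ℕ), ∀ S ∈ 𝒢, (∀ l, (S l).IsSymm) →
      ((∑ l, (X : ℝ[X]) ^ d l • (S l).map C).det.roots.toFinset.filter (fun x => 0 < x)).card ≤ B) :
    PosRootLawAt m K B :=
  fun d => posRootLawOn_of_denseRows hB d 𝒢 hdense (hrows d)

/-- **`DoorA34` is decided on any dense family of symmetric letter tuples**: `DoorA34` (`= PosRootLawAt 3 4 18`, `Iff.rfl`-equal to the
route item `Theses.LacunarySymmetroid.DoorA34`, stmt-ValiantsHypothesis-19980) holds iff every symmetric member of a family dense among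
symmetric tuples has `≤ 18` distinct positive det-roots on every support. [folklore] -/
theorem doorA34_iff_denseRows (𝒢 : Set (Fin 4 → Matrix (Fin 3) (Fin 3) ℝ))
    (hdense : ∀ S : Fin 4 → Matrix (Fin 3) (Fin 3) ℝ, (∀ l, (S l).IsSymm) →
      ∀ U : Set (Fin 4 → Matrix (Fin 3) (Fin 3) ℝ), IsOpen U → S ∈ U → ∃ S' ∈ 𝒢, (∀ l, (S' l).IsSymm) ∧ S' ∈ U) :
    DoorA34 ↔ ∀ (d : Fin 4 → ℕ), ∀ S ∈ 𝒢, (∀ l, (S l).IsSymm) →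
      ((∑ l, (X : ℝ[X]) ^ d l • (S l).map C).det.roots.toFinset.filter (fun x => 0 < x)).card ≤ 18 :=
  ⟨fun h d S _ hS => h d S hS, fun h => posRootLawAt_of_denseRows (by decide) 𝒢 hdense h⟩

/-- **`DoorA26` is decided on any dense family of symmetric letter tuples** (`DoorA26 = PosRootLawAt 2 6 19`, stmt-ValiantsHypothesis-19979).
[folklore] -/
theorem doorA26_iff_denseRows (𝒢 : Set (Fin 6 → Matrix (Fin 2) (Fin 2) ℝ))
    (hdense : ∀ S : Fin 6 → Matrix (Fin 2) (Fin 2) ℝ, (∀ l, (S l).IsSymm) →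
      ∀ U : Set (Fin 6 → Matrix (Fin 2) (Fin 2) ℝ), IsOpen U → S ∈ U → ∃ S' ∈ 𝒢, (∀ l, (S' l).IsSymm) ∧ S' ∈ U) :
    DoorA26 ↔ ∀ (d : Fin 6 → ℕ), ∀ S ∈ 𝒢, (∀ l, (S l).IsSymm) →
      ((∑ l, (X : ℝ[X]) ^ d l • (S l).map C).det.roots.toFinset.filter (fun x => 0 < x)).card ≤ 19 :=
  ⟨fun h d S _ hS => h d S hS, fun h => posRootLawAt_of_denseRows (by decide) 𝒢 hdense h⟩

end Summit.ValiantsHypothesis.ValiantsHypothesis.Theorems.LacunarySymmetroidMatrixDescartes.Census.DenseRows
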